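import Summits.ResolutionOfSingularities.ResolutionOfSingularities.Theorems.FactorCutCells
import HarnessLib

/-!
# FactorCutCells2 — decomp-res node «FactorCut» (lens-4 g33, critic row 191 CLEARED +1), tree file 4/5 of the node

Content VERBATIM from the decomp-res lens-4 g33 node `HOME/decomp-res-lens-4/g33/FactorCut.lean` (pin dd0f861c; NEW
part §99–§104 only; the node's carry of g32 rev 2 dropped in favour of `import …TauChainCutCells2`); HOME =
run/shared/lean/pub/decomp-res; critic row 191 CLEARED +1; landing orders INBOX :1049/:1051 — provenance, critic
text and the lens header in full in the first file of the node, `FactorCutKernels`.  Namespace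
`…Theorems.HugValuationCut`; `--supports stmt-ResolutionOfSingularities-28338`.

## This file

Continuation 2/2 of `FactorCutCells` (same sections of the node, cut at the 400-line cap): carries
`occult_divisorial_entrance_chart`, `occult_divisorial_factor_expand`, `occult_nonDivisorial_entrance_chart`.

[WRITER NOTE (decomp-res writer g12): file split only (tree files ≤ 400 lines); namespace, sections, section
variables / universes / opens and every declaration exactly as in the lens (the carry block and the node's global
dupNamespace-linter line are dropped — the library sets the latter; the two namespace-level `open
…AbsoluteContactClasses` / `open …Hironaka2005 (…)` lines of the new part are replayed in every file; the `open
…Theses` line and the lens's cone imports `MaxContactCutSatelliteCut` / `MaxContactCutWallCutCells` /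
`MaxContactCutSurfacePort` live only in the Theses-cone file `MaxContactCutFactorCut`).]

(Sources: Hironaka1964 Ch. III; Giraud1975 (Giraud's lemma); Kollar2007 3.58–3.60; CossartJannsenSaito2020 Thm.
6.40, Def. 6.38–6.39, Ch. 8; Hauser2010Kangaroo; HauserPerlega2019 §2; CossartPiltant2008 §2; CossartPiltant2019;
Hironaka2005 (three key theorems); EGAIV4 §16; Matsumura1987 §28; StacksProject 0804 / 0BIQ / 031I.)
-/

noncomputable section

open CategoryTheory AlgebraicGeometry IsLocalRing TopologicalSpace
open Literature.AlgebraicGeometry.Resolution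
open Summit.ResolutionOfSingularities.ResolutionOfSingularities.Theorems
open WeakOrderReduction ForcedTowerClasses DivergentTowerClasses MonomialTowerClasses
open HugDimensionClasses HugDimensionKernels SurfaceShadowClasses SurfaceShadowKernels
open NearPointCut (SingularClass)
open Scheme.IdealSheafData (vanishingIdeal)
open scoped BigOperators

namespace Summit.ResolutionOfSingularities.ResolutionOfSingularities.Theorems.HugValuationCut

open Summit.ResolutionOfSingularities.ResolutionOfSingularities.Theorems.AbsoluteContactClasses
  (IsAbsContactAt SepResidueAt AbsInv absInv_point sepResidueAt_of_perfectField)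
open Literature.AlgebraicGeometry.Resolution.Hironaka2005 (le_idealOrder_of_mul_le le_idealOrder_of_mul_le')

section OccultEntrances

variable {R : Type*} [CommRing R]

/-! ## §104 (g33 · ENTRANCE CERTIFICATES) kernel-checked chart identities of the occult profiles quoted in the cells' docstrings
(standard monomial substitutions of the point blow-up; identities over every commutative ring). -/

/-- (O1) the OCCULT DIVISORIAL profile `𝓘 = H·K`, `H = y² + x⁵ + x³u²`, `K = (y², u³, yu²)` (weights `(2,2)`, `n =
4`, `p = 2`) —
`x`-chart `y ↦ xy, u ↦ xu`: `H ↦ x²·(y² + x³ + x³u²)` (so `H₁ = y² + x³(1+u)²` over `𝔽₂`, weight-2 controlled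
transform, again of
order 2 at the origin) and the generators of `K` go to `x²·y²`, `x²·(xu³)`, `x²·(xyu²)` (so `K₁ = (y², xu³, xyu²)`,
again of order 2 at
the origin): the origin of the `x`-chart is a near point with the same occult mixed profile. [folklore] -/
theorem occult_divisorial_entrance_chart (x y u : R) :
    (x * y) ^ 2 + x ^ 5 + x ^ 3 * (x * u) ^ 2 = x ^ 2 * (y ^ 2 + x ^ 3 + x ^ 3 * u ^ 2) ∧
      (x * y) ^ 2 = x ^ 2 * y ^ 2 ∧ (x * u) ^ 3 = x ^ 2 * (x * u ^ 3) ∧ (x * y) * (x * u) ^ 2 = x ^ 2 * (x * y * u ^ 2) := by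
  refine ⟨by ring, by ring, by ring, by ring⟩

/-- (O1′) the factor `H = y² + x⁵ + x³u²` IS `y² + x³(x+u)²` in characteristic 2 (`2·x⁴u = 0`): the identity
`y² + x³(x+u)² = y² + x⁵ + x³u² + 2·x⁴u` over every commutative ring. [folklore] -/
theorem occult_divisorial_factor_expand (x y u : R) :
    y ^ 2 + x ^ 3 * (x + u) ^ 2 = y ^ 2 + x ^ 5 + x ^ 3 * u ^ 2 + 2 * (x ^ 4 * u) := by
  ring

/-- (O2) the OCCULT NON-DIVISORIAL profile `𝓘_0 = (y³ + x³u², u⁴, yu³)` (`n = p = 3`) — `x`-chart `y ↦ xy, u ↦ xu`: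
the generators go to
`x³·(y³ + x²u²)`, `x³·(xu⁴)`, `x³·(xyu³)`: weight-3 controlled transform `(y³ + x²u², xu⁴, xyu³)`, again of order 3
and height 2 at the
origin. [folklore] -/
theorem occult_nonDivisorial_entrance_chart (x y u : R) :
    (x * y) ^ 3 + x ^ 3 * (x * u) ^ 2 = x ^ 3 * (y ^ 3 + x ^ 2 * u ^ 2) ∧ (x * u) ^ 4 = x ^ 3 * (x * u ^ 4) ∧
      (x * y) * (x * u) ^ 3 = x ^ 3 * (x * y * u ^ 3) := by
  refine ⟨by ring, by ring, by ring⟩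

end OccultEntrances

end Summit.ResolutionOfSingularities.ResolutionOfSingularities.Theorems.HugValuationCut
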